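import Mathlib
import HarnessLib

/-!
# Alon's out-degree bound for Sperner capacity, and the Paley tournaments

Topic `Literature/Combinatorics/Extremal` (companion of `CyclicTriangleSpernerCapacity.lean`).

For a digraph `G` on a vertex set `V` write `ω(G^n)` for the largest cardinality of a set `S ⊆ V^n` of
words such that for every ORDERED pair of distinct words `(u, v)` of `S` some coordinate `i` carries an
arc `u i → v i` of `G` (Gargano–Körner–Vaccaro; the Sperner capacity of `G` is `lim (1/n) log ω(G^n)`).
N. Alon, *On the capacity of digraphs*, European J. Combin. 19 (1998) 1–5, proved (abstract / Theorem 1):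
if every out-degree of `G` is at most `d` then `ω(G^n) ≤ (d+1)^n`, so the capacity is at most
`log (d+1)`.  The proof is Blokhuis' polynomial method: the functions
`P_u(x) = ∏_i ∏_{w ∈ N⁺(u i)} (x_i - w)` vanish at every other word of `S` and not at `u`, hence are
linearly independent, and they lie in the `(d+1)^n`-dimensional span of the monomials `∏ x_i^{e_i}`,
`e_i ≤ d`.

* `card_le_pow_of_eval_polynomials` — the polynomial-method engine (one univariate polynomial of degree
  `≤ d` per word and coordinate; diagonal non-vanishing, off-diagonal vanishing);
* `length_le_pow_of_eval_polynomials` — its ordered form (triangular matrix: bounds transitive tournaments of `G^n`);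
* `card_le_pow_succ_of_outDegree_le` — Alon's theorem `ω(G^n) ≤ (d+1)^n`;
* `card_le_pow_of_paley_sperner` — the PALEY TOURNAMENT `P_q` (`a → b` iff `b - a` is a non-zero
  square in `ZMod q`, `q` prime): `|S| ≤ (q/2 + 1)^n = ((q+1)/2)^n`, i.e. `Σ(P_q) ≤ log((q+1)/2)`
  (Alon's bound with `d = (q-1)/2`; proved directly with `P_u(x) = ∏_i (1 - (x_i - u_i)^{(q-1)/2})` and
  Euler's criterion, which is Blokhuis' argument for `q = 3`);
* `length_le_pow_of_paley_chain` — transitive tournaments of `P_q^n` have at most `(q/2+1)^n` vertices;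
* `card_le_pow_of_paley_sperner_fin` — the same in the `Fin q`-valued vocabulary of the crux work-files
  of `Summits/MatrixMultiplication` (stub `stub_paleyCapacity` of item stmt-MatrixMultiplication-14308 asks
  for `|S| ≥ q^{(1-ε)n}`; the present ceiling `((q+1)/2)^n` leaves exactly that one-bit gap open);
* `exists_paley_sperner_card_eq` — the lower bound `ω(P_q^2) ≥ q` for `q ≡ 3 (mod 4)`: the anti-diagonal
  words `(x, -x)` (Sali–Simonyi 1999, Cor. 1, for vertex-transitive self-complementary graphs; here `-1` is a
  non-square, so of `d` and `-d` exactly one is a square), whence `Σ(P_q) ≥ ½ log q`.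

No definitions.

## References
* N. Alon, European J. Combin. 19 (1998) 1–5, Theorem 1 / abstract. [Alon1998CapacityDigraphs]
* A. Blokhuis, J. Algebraic Combin. 2 (1993) 123–124. [Blokhuis1993SpernerCapacityCyclicTriangle]
* A. Sali, G. Simonyi, European J. Combin. 20 (1999) 93–99, Corollary 1. [SaliSimonyi1999OrientationsSelfComplementary]
-/

namespace Literature.Combinatorics.Extremal

open Finset Polynomial

/-- **The polynomial-method engine (Blokhuis 1993 / Alon 1998).**  Let `S` be a finite set of words
`Fin n → V`, `ι : V → F` a map into a field, and suppose every word `u ∈ S` comes with univariate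
polynomials `pol u i ∈ F[X]` (`i : Fin n`) of degree `≤ d` such that `pol u i` does not vanish at
`ι (u i)` but for every other word `v ∈ S` some `pol u i` vanishes at `ι (v i)`.  Then `|S| ≤ (d+1)^n`:
the functions `x ↦ ∏_i (pol u i)(x_i)` are linearly independent (the matrix of their values on `S` is
diagonal with non-zero diagonal) and lie in the span of the `(d+1)^n` monomials `∏_i x_i^{e_i}`, `e_i ≤ d`.
[cite: Alon1998CapacityDigraphs, proof of Theorem 1] -/
theorem card_le_pow_of_eval_polynomials {F V : Type*} [Field F] [DecidableEq V]
    (ι : V → F) {n d : ℕ} (S : Finset (Fin n → V)) (pol : (Fin n → V) → Fin n → F[X])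
    (hdeg : ∀ u ∈ S, ∀ i, (pol u i).natDegree ≤ d)
    (hdiag : ∀ u ∈ S, ∀ i, (pol u i).eval (ι (u i)) ≠ 0)
    (hoff : ∀ u ∈ S, ∀ v ∈ S, u ≠ v → ∃ i, (pol u i).eval (ι (v i)) = 0) :
    S.card ≤ (d + 1) ^ n := by
  classical
  -- the functions `P u` and the monomials `M e`, as functions on `F^n`
  let P : (Fin n → V) → (Fin n → F) → F := fun u x => ∏ i, (pol u i).eval (x i)
  let M : (Fin n → Fin (d + 1)) → (Fin n → F) → F := fun e x => ∏ i, x i ^ (e i : ℕ)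
  let W : Submodule F ((Fin n → F) → F) := Submodule.span F (Set.range M)
  -- (1) every `P u`, `u ∈ S`, lies in the span `W` of the `(d+1)^n` monomials
  have hPW : ∀ u ∈ S, P u ∈ W := by
    intro u hu
    have hexp : P u = ∑ e : Fin n → Fin (d + 1), (∏ i, (pol u i).coeff (e i)) • M e := by
      funext x
      rw [Finset.sum_apply]
      simp only [P, M, Pi.smul_apply, smul_eq_mul]
      have heval : ∀ i, (pol u i).eval (x i) =
          ∑ j : Fin (d + 1), (pol u i).coeff j * x i ^ (j : ℕ) := by
        intro i
        rw [Polynomial.eval_eq_sum_range' (Nat.lt_succ_of_le (hdeg u hu i)) (x i)]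
        exact (Fin.sum_univ_eq_sum_range (fun j => (pol u i).coeff j * x i ^ j) (d + 1)).symm
      simp_rw [heval]
      rw [Fintype.prod_sum]
      refine Finset.sum_congr rfl fun e _ => ?_
      rw [Finset.prod_mul_distrib]
    rw [hexp]
    refine Submodule.sum_mem _ fun e _ => Submodule.smul_mem _ _ ?_
    exact Submodule.subset_span ⟨e, rfl⟩
  -- (2) evaluations at the embedded words
  have hzero : ∀ u ∈ S, ∀ v ∈ S, u ≠ v → P u (ι ∘ v) = 0 := by
    intro u hu v hv hne
    obtain ⟨i, hi⟩ := hoff u hu v hv hne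
    exact Finset.prod_eq_zero (Finset.mem_univ i) (by simpa using hi)
  have hne0 : ∀ u ∈ S, P u (ι ∘ u) ≠ 0 := by
    intro u hu
    exact Finset.prod_ne_zero_iff.mpr fun i _ => by simpa using hdiag u hu i
  -- (3) linear independence of `(P u)_{u ∈ S}` inside `W`
  have hli : LinearIndependent F (fun u : S => (⟨P u, hPW u u.2⟩ : W)) := by
    apply LinearIndependent.of_comp W.subtype
    rw [linearIndependent_iff']
    intro s g hg u hu
    have h := congrFun hg (ι ∘ (u : Fin n → V))
    rw [Finset.sum_apply] at h
    simp only [Function.comp_apply, Submodule.subtype_apply, Pi.smul_apply, smul_eq_mul,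
      Pi.zero_apply] at h
    rw [Finset.sum_eq_single u] at h
    · exact (mul_eq_zero.mp h).resolve_right (hne0 _ u.2)
    · intro v _ hvu
      have hne : (v : Fin n → V) ≠ u := fun e => hvu (Subtype.ext e)
      rw [hzero _ v.2 _ u.2 hne, mul_zero]
    · intro hu'
      exact absurd hu hu'
  -- (4) count dimensions
  haveI : Module.Finite F W := Module.Finite.span_of_finite F (Set.finite_range M)
  have h1 : Fintype.card S ≤ Module.finrank F W := hli.fintype_card_le_finrank
  have h2 : Module.finrank F W ≤ Fintype.card (Fin n → Fin (d + 1)) := finrank_range_le_card M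
  rw [Fintype.card_coe] at h1
  rw [Fintype.card_fun, Fintype.card_fin, Fintype.card_fin] at h2
  exact h1.trans h2


/-- **The ordered (transitive-tournament) form of the engine.**  If `s₀, …, s_{N-1}` is a SEQUENCE of
words and word `a` comes with polynomials `pol a i` of degree `≤ d`, non-vanishing at `ι (s a i)`, such
that for every LATER word `b > a` some `pol a i` vanishes at `ι (s b i)`, then `N ≤ (d+1)^n`: the matrix
of values is triangular with non-zero diagonal, so the functions are still linearly independent.  (With
Alon's / the Paley polynomials this bounds the largest transitive tournament of `G^n`, the quantity whose
growth rate is the Sperner capacity in the Sali–Simonyi formulation.)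
[cite: Alon1998CapacityDigraphs, proof of Theorem 1] [cite: SaliSimonyi1999OrientationsSelfComplementary, Definition 2] -/
theorem length_le_pow_of_eval_polynomials {F V : Type*} [Field F] [DecidableEq V]
    (ι : V → F) {n d N : ℕ} (s : Fin N → (Fin n → V)) (pol : Fin N → Fin n → F[X])
    (hdeg : ∀ a i, (pol a i).natDegree ≤ d)
    (hdiag : ∀ a i, (pol a i).eval (ι (s a i)) ≠ 0)
    (hoff : ∀ a b, a < b → ∃ i, (pol a i).eval (ι (s b i)) = 0) :
    N ≤ (d + 1) ^ n := by
  classical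
  let P : Fin N → (Fin n → F) → F := fun a x => ∏ i, (pol a i).eval (x i)
  let M : (Fin n → Fin (d + 1)) → (Fin n → F) → F := fun e x => ∏ i, x i ^ (e i : ℕ)
  let W : Submodule F ((Fin n → F) → F) := Submodule.span F (Set.range M)
  have hPW : ∀ a, P a ∈ W := by
    intro a
    have hexp : P a = ∑ e : Fin n → Fin (d + 1), (∏ i, (pol a i).coeff (e i)) • M e := by
      funext x
      rw [Finset.sum_apply]
      simp only [P, M, Pi.smul_apply, smul_eq_mul]
      have heval : ∀ i, (pol a i).eval (x i) =
          ∑ j : Fin (d + 1), (pol a i).coeff j * x i ^ (j : ℕ) := by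
        intro i
        rw [Polynomial.eval_eq_sum_range' (Nat.lt_succ_of_le (hdeg a i)) (x i)]
        exact (Fin.sum_univ_eq_sum_range (fun j => (pol a i).coeff j * x i ^ j) (d + 1)).symm
      simp_rw [heval]
      rw [Fintype.prod_sum]
      refine Finset.sum_congr rfl fun e _ => ?_
      rw [Finset.prod_mul_distrib]
    rw [hexp]
    refine Submodule.sum_mem _ fun e _ => Submodule.smul_mem _ _ ?_
    exact Submodule.subset_span ⟨e, rfl⟩
  have hzero : ∀ a b, a < b → P a (ι ∘ s b) = 0 := by
    intro a b hab
    obtain ⟨i, hi⟩ := hoff a b hab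
    exact Finset.prod_eq_zero (Finset.mem_univ i) (by simpa using hi)
  have hne0 : ∀ a, P a (ι ∘ s a) ≠ 0 := fun a =>
    Finset.prod_ne_zero_iff.mpr fun i _ => by simpa using hdiag a i
  -- triangular ⇒ linearly independent: peel off the maximal index
  have hli : LinearIndependent F (fun a : Fin N => (⟨P a, hPW a⟩ : W)) := by
    apply LinearIndependent.of_comp W.subtype
    rw [linearIndependent_iff']
    intro t
    refine Finset.induction_on_max t (fun g _ a ha => absurd ha (Finset.notMem_empty a)) ?_
    intro m t hlt ih g hg a ha
    have hm : m ∉ t := fun h => lt_irrefl m (hlt m h)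
    rw [Finset.sum_insert hm] at hg
    -- evaluate at the word `s m`: every earlier function vanishes there
    have hgm : g m = 0 := by
      have h := congrFun hg (ι ∘ s m)
      simp only [Pi.add_apply, Finset.sum_apply, Function.comp_apply, Submodule.subtype_apply,
        Pi.smul_apply, smul_eq_mul, Pi.zero_apply] at h
      rw [Finset.sum_eq_zero (fun x hx => by rw [hzero x m (hlt x hx), mul_zero]), add_zero] at h
      exact (mul_eq_zero.mp h).resolve_right (hne0 m)
    rw [hgm, zero_smul, zero_add] at hg
    rcases Finset.mem_insert.mp ha with rfl | ha'
    · exact hgm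
    · exact ih g hg a ha'
  haveI : Module.Finite F W := Module.Finite.span_of_finite F (Set.finite_range M)
  have h1 : Fintype.card (Fin N) ≤ Module.finrank F W := hli.fintype_card_le_finrank
  have h2 : Module.finrank F W ≤ Fintype.card (Fin n → Fin (d + 1)) := finrank_range_le_card M
  rw [Fintype.card_fin] at h1
  rw [Fintype.card_fun, Fintype.card_fin, Fintype.card_fin] at h2
  exact h1.trans h2

/-- **Alon (1998), the out-degree bound.**  Let `G` be a loopless digraph on a finite vertex set `V`,
given by its out-neighbourhoods `E v` (`v ∉ E v`), all of size `≤ d`.  If `S ⊆ V^n` is a set of words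
such that every ordered pair of distinct words `(u, v)` has a coordinate `i` with an arc `u i → v i`
(`v i ∈ E (u i)`), then `|S| ≤ (d+1)^n`.  Consequently the Sperner capacity of `G` is at most
`log (d+1)`. [cite: Alon1998CapacityDigraphs, Theorem 1 (abstract: "if G has maximum outdegree d
then C(G) ≤ d+1")] -/
theorem card_le_pow_succ_of_outDegree_le {V : Type*} [DecidableEq V] [Fintype V]
    (E : V → Finset V) (hloop : ∀ v, v ∉ E v) {d : ℕ} (hd : ∀ v, (E v).card ≤ d)
    {n : ℕ} (S : Finset (Fin n → V))
    (hS : ∀ u ∈ S, ∀ v ∈ S, u ≠ v → ∃ i, v i ∈ E (u i)) :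
    S.card ≤ (d + 1) ^ n := by
  classical
  -- embed the vertices into `ℚ`
  let ι : V → ℚ := fun v => ((Fintype.equivFin V v : ℕ) : ℚ)
  have hι : Function.Injective ι := fun a b h => by
    have h' : ((Fintype.equivFin V a : ℕ) : ℚ) = ((Fintype.equivFin V b : ℕ) : ℚ) := h
    exact (Fintype.equivFin V).injective (Fin.ext (Nat.cast_injective h'))
  -- Alon's polynomials `∏_{w ∈ E (u i)} (X - ι w)`
  let pol : (Fin n → V) → Fin n → ℚ[X] := fun u i => ∏ w ∈ E (u i), (X - C (ι w))
  refine card_le_pow_of_eval_polynomials ι S pol ?_ ?_ ?_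
  · intro u _ i
    calc (pol u i).natDegree ≤ ∑ w ∈ E (u i), (X - C (ι w)).natDegree :=
          Polynomial.natDegree_prod_le _ _
      _ ≤ ∑ w ∈ E (u i), 1 :=
          Finset.sum_le_sum (f := fun w => (X - C (ι w)).natDegree) (g := fun _ => 1)
            fun w _ => Polynomial.natDegree_X_sub_C_le (ι w)
      _ ≤ d := by simpa using hd (u i)
  · intro u _ i
    simp only [pol, Polynomial.eval_prod, Polynomial.eval_sub, Polynomial.eval_X,
      Polynomial.eval_C]
    refine Finset.prod_ne_zero_iff.mpr fun w hw => sub_ne_zero.mpr fun h => ?_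
    exact hloop (u i) (hι h ▸ hw)
  · intro u hu v hv hne
    obtain ⟨i, hi⟩ := hS u hu v hv hne
    refine ⟨i, ?_⟩
    simp only [pol, Polynomial.eval_prod, Polynomial.eval_sub, Polynomial.eval_X,
      Polynomial.eval_C]
    exact Finset.prod_eq_zero hi (sub_self _)

/-- **The Paley tournaments: `Σ(P_q) ≤ log ((q+1)/2)` (Alon 1998; Blokhuis' polynomials).**  Let `q` be
a prime and `S ⊆ (ZMod q)^n` a set of words such that every ordered pair of distinct words `(u, v)` has
a coordinate `i` with `v i - u i` a NON-ZERO SQUARE (an arc `u i → v i` of the Paley digraph).  Then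
`|S| ≤ (q/2 + 1)^n` (`= ((q+1)/2)^n` for odd `q`).  Proof: `P_u(x) = ∏_i (1 - (x_i - u_i)^{q/2})` has
degree `q/2` in each variable, `P_u(u) = 1`, and `P_u(v) = 0` by Euler's criterion
`(v i - u i)^{(q-1)/2} = 1`. [cite: Alon1998CapacityDigraphs, Theorem 1 with d = (q-1)/2]
[cite: Blokhuis1993SpernerCapacityCyclicTriangle, Theorem (the case q = 3)] -/
theorem card_le_pow_of_paley_sperner {q : ℕ} [hq : Fact q.Prime] {n : ℕ}
    (S : Finset (Fin n → ZMod q))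
    (hS : ∀ u ∈ S, ∀ v ∈ S, u ≠ v → ∃ i, u i ≠ v i ∧ IsSquare (v i - u i)) :
    S.card ≤ (q / 2 + 1) ^ n := by
  classical
  have hk : q / 2 ≠ 0 := (Nat.div_pos hq.out.two_le two_pos).ne'
  let pol : (Fin n → ZMod q) → Fin n → (ZMod q)[X] := fun u i => C 1 - (X - C (u i)) ^ (q / 2)
  refine card_le_pow_of_eval_polynomials id S pol ?_ ?_ ?_
  · intro u _ i
    calc (pol u i).natDegree ≤ max (C (1 : ZMod q)).natDegree (((X - C (u i)) ^ (q / 2)).natDegree) :=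
          Polynomial.natDegree_sub_le _ _
      _ ≤ q / 2 := by
          refine max_le (by simp) ((Polynomial.natDegree_pow_le).trans ?_)
          calc q / 2 * (X - C (u i)).natDegree ≤ q / 2 * 1 :=
                Nat.mul_le_mul_left _ (Polynomial.natDegree_X_sub_C_le _)
            _ = q / 2 := mul_one _
  · intro u _ i
    simp [pol, zero_pow hk]
  · intro u hu v hv hne
    obtain ⟨i, hne_i, hsq⟩ := hS u hu v hv hne
    refine ⟨i, ?_⟩
    have hd : v i - u i ≠ 0 := sub_ne_zero.mpr (Ne.symm hne_i)
    have h1 : (v i - u i) ^ (q / 2) = 1 := (ZMod.euler_criterion q hd).mp hsq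
    simp [pol, h1]


/-- **Transitive tournaments in powers of the Paley tournament.**  If `s₀, …, s_{N-1}` are words in
`(ZMod q)^n` (`q` prime) such that for all `a < b` some coordinate `i` has `s b i - s a i` a non-zero
square (the words span a transitive tournament of `P_q^n`, earlier words pointing to later ones), then
`N ≤ (q/2 + 1)^n`.  [cite: Alon1998CapacityDigraphs, Theorem 1 with d = (q-1)/2] -/
theorem length_le_pow_of_paley_chain {q : ℕ} [hq : Fact q.Prime] {n N : ℕ}
    (s : Fin N → (Fin n → ZMod q))
    (hs : ∀ a b : Fin N, a < b → ∃ i, s a i ≠ s b i ∧ IsSquare (s b i - s a i)) :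
    N ≤ (q / 2 + 1) ^ n := by
  classical
  have hk : q / 2 ≠ 0 := (Nat.div_pos hq.out.two_le two_pos).ne'
  let pol : Fin N → Fin n → (ZMod q)[X] := fun a i => C 1 - (X - C (s a i)) ^ (q / 2)
  refine length_le_pow_of_eval_polynomials id s pol ?_ ?_ ?_
  · intro a i
    calc (pol a i).natDegree ≤ max (C (1 : ZMod q)).natDegree (((X - C (s a i)) ^ (q / 2)).natDegree) :=
          Polynomial.natDegree_sub_le _ _
      _ ≤ q / 2 := by
          refine max_le (by simp) ((Polynomial.natDegree_pow_le).trans ?_)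
          calc q / 2 * (X - C (s a i)).natDegree ≤ q / 2 * 1 :=
                Nat.mul_le_mul_left _ (Polynomial.natDegree_X_sub_C_le _)
            _ = q / 2 := mul_one _
  · intro a i
    simp [pol, zero_pow hk]
  · intro a b hab
    obtain ⟨i, hne_i, hsq⟩ := hs a b hab
    refine ⟨i, ?_⟩
    have hd : s b i - s a i ≠ 0 := sub_ne_zero.mpr (Ne.symm hne_i)
    have h1 : (s b i - s a i) ^ (q / 2) = 1 := (ZMod.euler_criterion q hd).mp hsq
    simp [pol, h1]

/-- The same bound in the `Fin q`-valued vocabulary used by the crux work-files of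
`Summits/MatrixMultiplication` (item stmt-MatrixMultiplication-14308, stub `stub_paleyCapacity`, which asks
for such word sets of size `≥ q^{(1-ε)n}`): if every ordered pair of distinct words `u ≠ w` of
`W ⊆ (Fin q)^n` has a coordinate `t` with `u t ≠ w t` and `(w t : ZMod q) - (u t : ZMod q)` a square,
then `|W| ≤ (q/2 + 1)^n`.  (So the stub sits in the one-bit gap between `½ log q` and `log((q+1)/2)`;
this theorem does not refute it.) [cite: Alon1998CapacityDigraphs, Theorem 1] -/
theorem card_le_pow_of_paley_sperner_fin {q : ℕ} [hq : Fact q.Prime] {n : ℕ}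
    (W : Finset (Fin n → Fin q))
    (hW : ∀ u ∈ W, ∀ w ∈ W, u ≠ w →
      ∃ t : Fin n, u t ≠ w t ∧ IsSquare (((w t : ℕ) : ZMod q) - ((u t : ℕ) : ZMod q))) :
    W.card ≤ (q / 2 + 1) ^ n := by
  classical
  let φ : (Fin n → Fin q) → (Fin n → ZMod q) := fun w t => ((w t : ℕ) : ZMod q)
  have hcast : ∀ a b : Fin q, ((a : ℕ) : ZMod q) = ((b : ℕ) : ZMod q) → a = b := by
    intro a b h
    apply Fin.ext
    have := (ZMod.natCast_eq_natCast_iff' a b q).mp h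
    rwa [Nat.mod_eq_of_lt a.isLt, Nat.mod_eq_of_lt b.isLt] at this
  have hφ : Function.Injective φ := fun a b h => funext fun t => hcast _ _ (congrFun h t)
  rw [← Finset.card_image_of_injective W hφ]
  refine card_le_pow_of_paley_sperner (W.image φ) ?_
  simp only [Finset.mem_image]
  rintro _ ⟨u, hu, rfl⟩ _ ⟨w, hw, rfl⟩ hne
  have hne' : u ≠ w := fun e => hne (by rw [e])
  obtain ⟨t, ht, hsq⟩ := hW u hu w hw hne'
  exact ⟨t, fun e => ht (hcast _ _ e), hsq⟩

/-- **The lower bound `ω(P_q^2) ≥ q` for `q ≡ 3 (mod 4)` (the self-converse trick; Sali–Simonyi 1999,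
Cor. 1, Alon 1998).**  The `q` anti-diagonal words `(x, -x)` in `(ZMod q)^2` are pairwise separated in
both directions: for `x ≠ y` the two coordinate differences are `d = y - x ≠ 0` and `-d`, and since `-1`
is a non-square modulo a prime `q ≡ 3 (mod 4)` exactly one of them is a square.  Hence (taking powers)
`ω(P_q^{2j}) ≥ q^j` and `Σ(P_q) ≥ ½ log q`. [cite: SaliSimonyi1999OrientationsSelfComplementary, Corollary 1] -/
theorem exists_paley_sperner_card_eq {q : ℕ} [hq : Fact q.Prime] (hq3 : q % 4 = 3) :
    ∃ S : Finset (Fin 2 → ZMod q), S.card = q ∧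
      ∀ u ∈ S, ∀ v ∈ S, u ≠ v → ∃ i, u i ≠ v i ∧ IsSquare (v i - u i) := by
  classical
  let a : ZMod q → (Fin 2 → ZMod q) := fun x => ![x, -x]
  have ha : Function.Injective a := fun x y h => by
    have := congrFun h 0
    simpa [a] using this
  refine ⟨Finset.univ.image a, ?_, ?_⟩
  · rw [Finset.card_image_of_injective _ ha, Finset.card_univ, ZMod.card]
  · simp only [Finset.mem_image, Finset.mem_univ, true_and]
    rintro _ ⟨x, rfl⟩ _ ⟨y, rfl⟩ hne
    have hxy : x ≠ y := fun e => hne (by rw [e])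
    have hd : y - x ≠ 0 := sub_ne_zero.mpr (Ne.symm hxy)
    -- `-1` is a non-square, so the quadratic character of `-1` is `-1`
    have hm1 : ¬ IsSquare (-1 : ZMod q) := by
      rw [ZMod.exists_sq_eq_neg_one_iff]; omega
    by_cases hsq : IsSquare (y - x)
    · exact ⟨0, by simpa [a] using hxy, by simpa [a] using hsq⟩
    · refine ⟨1, by simpa [a] using hxy, ?_⟩
      have hχd : quadraticChar (ZMod q) (y - x) = -1 :=
        (quadraticChar_neg_one_iff_not_isSquare).mpr hsq
      have hχm : quadraticChar (ZMod q) (-1) = -1 :=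
        (quadraticChar_neg_one_iff_not_isSquare).mpr hm1
      have hχ : quadraticChar (ZMod q) (-y - -x) = 1 := by
        have : (-y - -x : ZMod q) = (-1) * (y - x) := by ring
        rw [this, map_mul, hχm, hχd]; norm_num
      have hne0 : (-y - -x : ZMod q) ≠ 0 := by
        intro h0; apply hd; linear_combination -h0
      simpa [a] using (quadraticChar_one_iff_isSquare hne0).mp hχ

end Literature.Combinatorics.Extremal
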